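import Literature.AlgebraicGeometry.Resolution.HironakaDirectrixSpan
import HarnessLib

/-!
# `τ` under a homomorphism of coefficient fields (infrastructure for CoP1 (12): comparing `τ(x′)` and `τ(x)` at a rational near point)

Topic: `Literature/AlgebraicGeometry/Resolution`. [CoP1] = Cossart–Piltant, J. Algebra 320 (2008),
proof of Prop. 4.2 (b) and Lemma 4.3 (3): "If `x′` is near `x`, then `τ(x′) ≥ τ(x)` …
`T_{x′} + k(x′) Y_1′ = <Y_1′, Y_2′, Y_3′>` (12)". The initial forms at `x` live in
`k(x)[Y]`, those at `x′` in `k(x′)[Y′]`, and at a rational near point `k(x) → k(x′)` is an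
isomorphism; this file provides the transport of `τ` along a homomorphism of coefficient fields
`θ : k → k′` (all [folklore], proved):

* `dualBaseChange θ ℓ` — the linear form `Σ_i θ(ℓ(e_i)) Y_i^∨` over `k′`;
  `map_linearFormPoly` — `θ_*(linearFormPoly ℓ) = linearFormPoly (dualBaseChange θ ℓ)`;
* `map_mem_linearFormsSubalgebra` — `θ_*(k[T]) ⊆ k′[θ_* T]`;
* `hironakaTau_image_map_le` — `τ_{k′}(θ_* S) ≤ τ_k(S)` for any field homomorphism `θ`;
  `hironakaTau_image_map_eq` — equality for an isomorphism.

## Sources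

* V. Cossart, O. Piltant, J. Algebra 320 (2008) 1051–1082, proof of Prop. 4.2 (b), (12).
  [CossartPiltant2008]
-/

open MvPolynomial

noncomputable section

namespace Literature.AlgebraicGeometry.Resolution

universe u v

variable {k : Type u} {k' : Type v} [Field k] [Field k'] (θ : k →+* k') {d : ℕ}

/-- **Base change of a linear form along `θ`**: `Σ_i θ(ℓ(e_i)) Y_i^∨`. [folklore] -/
def dualBaseChange (ℓ : Module.Dual k (Fin d → k)) : Module.Dual k' (Fin d → k') :=
  ∑ i, θ (ℓ (Pi.single i 1)) • (LinearMap.proj i : Module.Dual k' (Fin d → k'))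

/-- Values on the standard basis. [folklore] -/
theorem dualBaseChange_single (ℓ : Module.Dual k (Fin d → k)) (i : Fin d) :
    dualBaseChange θ ℓ (Pi.single i 1) = θ (ℓ (Pi.single i 1)) := by
  classical
  simp only [dualBaseChange, LinearMap.coe_sum, Finset.sum_apply, LinearMap.smul_apply,
    LinearMap.coe_proj, Function.eval, Pi.single_apply, smul_eq_mul, mul_ite, mul_one, mul_zero,
    Finset.sum_ite_eq', Finset.mem_univ, if_true]

/-- Two linear forms on `k'^d` agreeing on the standard basis are equal. [folklore] -/
theorem dual_ext {ℓ ℓ' : Module.Dual k' (Fin d → k')}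
    (h : ∀ i, ℓ (Pi.single i 1) = ℓ' (Pi.single i 1)) : ℓ = ℓ' := by
  refine LinearMap.ext fun w => ?_
  rw [dual_apply_eq_sum k' ℓ w, dual_apply_eq_sum k' ℓ' w]
  exact Finset.sum_congr rfl fun i _ => by rw [h i]

/-- Additivity. [folklore] -/
theorem dualBaseChange_add (ℓ ℓ' : Module.Dual k (Fin d → k)) :
    dualBaseChange θ (ℓ + ℓ') = dualBaseChange θ ℓ + dualBaseChange θ ℓ' :=
  dual_ext fun i => by simp only [dualBaseChange_single, LinearMap.add_apply, map_add]

/-- `θ`-semilinearity. [folklore] -/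
theorem dualBaseChange_smul (a : k) (ℓ : Module.Dual k (Fin d → k)) :
    dualBaseChange θ (a • ℓ) = θ a • dualBaseChange θ ℓ :=
  dual_ext fun i => by
    simp only [dualBaseChange_single, LinearMap.smul_apply, smul_eq_mul, map_mul]

/-- Zero. [folklore] -/
theorem dualBaseChange_zero : dualBaseChange θ (0 : Module.Dual k (Fin d → k)) = 0 :=
  dual_ext fun i => by simp only [dualBaseChange_single, LinearMap.zero_apply, map_zero]

/-- Sums. [folklore] -/
theorem dualBaseChange_sum {ι : Type*} (s : Finset ι) (f : ι → Module.Dual k (Fin d → k)) :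
    dualBaseChange θ (∑ i ∈ s, f i) = ∑ i ∈ s, dualBaseChange θ (f i) := by
  classical
  induction s using Finset.induction_on with
  | empty => rw [Finset.sum_empty, Finset.sum_empty, dualBaseChange_zero]
  | insert a s ha ih => rw [Finset.sum_insert ha, Finset.sum_insert ha, dualBaseChange_add, ih]

/-- **`θ_*` of a linear form is a linear form.** [folklore] -/
theorem map_linearFormPoly (ℓ : Module.Dual k (Fin d → k)) :
    MvPolynomial.map θ (linearFormPoly k ℓ) = linearFormPoly k' (dualBaseChange θ ℓ) := by
  simp only [linearFormPoly, map_sum, map_mul, map_C, map_X, dualBaseChange_single]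

/-- **`θ_*(k[T]) ⊆ k′[θ_* T]`**: the image under `θ_*` of a polynomial in the linear forms of `T`
is a polynomial in the linear forms `θ_* ℓ`, `ℓ ∈ T`. [folklore] -/
theorem map_mem_linearFormsSubalgebra (T : Submodule k (Module.Dual k (Fin d → k)))
    {F : MvPolynomial (Fin d) k} (hF : F ∈ linearFormsSubalgebra k T) :
    MvPolynomial.map θ F ∈
      linearFormsSubalgebra k' (Submodule.span k' (dualBaseChange θ '' (T : Set _))) := by
  unfold linearFormsSubalgebra at hF ⊢
  induction hF using Algebra.adjoin_induction with
  | mem G hG =>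
    obtain ⟨ℓ, hℓ, rfl⟩ := hG
    rw [map_linearFormPoly]
    exact Algebra.subset_adjoin ⟨dualBaseChange θ ℓ, Submodule.subset_span ⟨ℓ, hℓ, rfl⟩, rfl⟩
  | algebraMap a =>
    rw [MvPolynomial.algebraMap_eq, map_C, ← MvPolynomial.algebraMap_eq]
    exact Subalgebra.algebraMap_mem _ _
  | add G H _ _ ihG ihH => rw [map_add]; exact Subalgebra.add_mem _ ihG ihH
  | mul G H _ _ ihG ihH => rw [map_mul]; exact Subalgebra.mul_mem _ ihG ihH

/-- **`τ` does not increase under base change of the coefficient field**: for any field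
homomorphism `θ : k → k′` and any set `S` of polynomials, `τ_{k′}(θ_* S) ≤ τ_k(S)` (if
`S ⊆ k[T]` with `dim T = τ(S)`, then `θ_* S ⊆ k′[θ_* T]` and `dim_{k′} span(θ_* T) ≤ dim_k T`).
[cite: CossartPiltant2008, proof of Prop. 4.2 (b)] -/
theorem hironakaTau_image_map_le (S : Set (MvPolynomial (Fin d) k)) :
    hironakaTau k' (MvPolynomial.map θ '' S) ≤ hironakaTau k S := by
  classical
  obtain ⟨T, hST, hT⟩ := exists_subset_linearFormsSubalgebra_finrank_eq k S
  haveI : Module.Free k T := Module.Free.of_divisionRing k T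
  haveI : Module.Finite k T := Module.IsNoetherian.finite k T
  let b := Module.finBasis k T
  obtain ⟨T', hT'⟩ : ∃ T' : Submodule k' (Module.Dual k' (Fin d → k')),
      T' = Submodule.span k' (Set.range fun i => dualBaseChange θ (b i : Module.Dual k (Fin d → k))) :=
    ⟨_, rfl⟩
  -- `θ_* T ⊆ T'`
  have himage : Submodule.span k' (dualBaseChange θ '' (T : Set _)) ≤ T' := by
    rw [Submodule.span_le]
    rintro _ ⟨ℓ, hℓ, rfl⟩
    have hrepr : (⟨ℓ, hℓ⟩ : T) = ∑ i, b.repr ⟨ℓ, hℓ⟩ i • b i := (b.sum_repr ⟨ℓ, hℓ⟩).symm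
    have hℓeq : ℓ = ∑ i, b.repr ⟨ℓ, hℓ⟩ i • (b i : Module.Dual k (Fin d → k)) := by
      have := congr_arg Subtype.val hrepr
      simpa only [Submodule.coe_sum, Submodule.coe_smul] using this
    rw [SetLike.mem_coe, hℓeq, dualBaseChange_sum]
    refine Submodule.sum_mem _ fun i _ => ?_
    rw [dualBaseChange_smul, hT']
    exact Submodule.smul_mem _ _ (Submodule.subset_span ⟨i, rfl⟩)
  -- `θ_* S ⊆ k′[T']`
  have hsub : MvPolynomial.map θ '' S ⊆ linearFormsSubalgebra k' T' := by
    rintro _ ⟨F, hF, rfl⟩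
    have h := map_mem_linearFormsSubalgebra θ T (hST hF)
    exact (Algebra.adjoin_mono (Set.image_mono himage)) h
  refine (hironakaTau_le_finrank_of_subset k' hsub).trans ?_
  rw [hT', ← hT]
  exact (finrank_range_le_card _).trans (by rw [Fintype.card_fin])

/-- `θ_* (θ⁻¹_* S) = S` for an isomorphism `θ`. [folklore] -/
theorem image_map_image_map_symm (e : k ≃+* k') (S : Set (MvPolynomial (Fin d) k')) :
    MvPolynomial.map (e : k →+* k') '' (MvPolynomial.map (e.symm : k' →+* k) '' S) = S := by
  ext F
  constructor
  · rintro ⟨_, ⟨G, hG, rfl⟩, rfl⟩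
    rw [MvPolynomial.map_map, show (e : k →+* k').comp (e.symm : k' →+* k) = RingHom.id k' from
      RingHom.ext fun a => e.apply_symm_apply a, MvPolynomial.map_id]
    exact hG
  · intro hF
    refine ⟨MvPolynomial.map (e.symm : k' →+* k) F, ⟨F, hF, rfl⟩, ?_⟩
    rw [MvPolynomial.map_map, show (e : k →+* k').comp (e.symm : k' →+* k) = RingHom.id k' from
      RingHom.ext fun a => e.apply_symm_apply a, MvPolynomial.map_id]

/-- **`τ` is invariant under an isomorphism of coefficient fields** (at a rational near point
`k(x) ≅ k(x′)`). [cite: CossartPiltant2008, proof of Prop. 4.2 (b)] -/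
theorem hironakaTau_image_map_eq (e : k ≃+* k') (S : Set (MvPolynomial (Fin d) k)) :
    hironakaTau k' (MvPolynomial.map (e : k →+* k') '' S) = hironakaTau k S := by
  refine le_antisymm (hironakaTau_image_map_le (e : k →+* k') S) ?_
  have h := hironakaTau_image_map_le (e.symm : k' →+* k) (MvPolynomial.map (e : k →+* k') '' S)
  have heq : MvPolynomial.map (e.symm : k' →+* k) '' (MvPolynomial.map (e : k →+* k') '' S) = S := by
    have := image_map_image_map_symm e.symm S
    simpa only [RingEquiv.symm_symm] using this
  rwa [heq] at h

end Literature.AlgebraicGeometry.Resolution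

end
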